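import Literature.Analysis.FluidPDE.NormalisedPressureDisjointAdd
import HarnessLib

/-!
# The normalised pressure of a finite disjointly supported sum

Analysis/FluidPDE support file (serves the discharge path of the barrier fact
`Literature.Barriers.NavierStokesRegularity.NSICantorBlock_of_arrangement`: Ożański 2017,
arXiv:1709.00602v4, Proposition 16, whose field (6.22) `v = Σ_{𝔪=1}^{𝔐}(u[a₁v₁^𝔪,q₁^𝔪] + u[a₂v₂^𝔪,q₂^𝔪])`
is a sum of `2𝔐` pairwise disjointly supported pieces and whose pressure function is,
§6.3 Step 3, (6.23): "`p̄(t) = Σ_{𝔪=1}^{𝔐}(p*[a₁^{𝔪,k}v₁^𝔪, q₁^{𝔪,k}] + p*[a₂^{𝔪,k}v₂^𝔪, q₂^{𝔪,k}])`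
(recall Lemma 4 (iii))"). The accepted `NormalisedPressureDisjointAdd` proves Lemma 4 (iii) for
two summands; here it is iterated over a `Finset`:

* `normalisedPressure_sum_of_disjoint_of_contDiff` — for finitely many `C¹` finite-energy fields
  on `ℝ³` with pairwise (pointwise) disjoint supports, the sum has finite energy and
  `p̃[Σᵢ uᵢ] = Σᵢ p̃[uᵢ]`.

## References

* W. S. Ożański, arXiv:1709.00602v4 (2017/2019), Lemma 4 (iii) (= Lemma 3.2 (iii) of v4) and
  §6.3 Step 3 (6.23). [`Ozanski2017NSISingular`]
-/

noncomputable section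

open MeasureTheory Finset
open scoped ENNReal

namespace Literature.Analysis.FluidPDE

/-- **The pressure function of a finite disjointly supported sum** (Ożański 2017, Lemma 4 (iii)
iterated; §6.3 Step 3, (6.23): the pressure function of `v = Σ_𝔪(u[a₁v₁^𝔪,q₁^𝔪] + u[a₂v₂^𝔪,q₂^𝔪])`
is the sum of the pressure functions of the pieces). For `C¹` finite-energy fields `uᵢ`, `i ∈ s`,
on `ℝ³` with pairwise disjoint supports (at every point at most one of any two is nonzero), the
sum `Σ_{i∈s} uᵢ` has finite energy and `p̃[Σ_{i∈s} uᵢ] = Σ_{i∈s} p̃[uᵢ]`.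
[cite: Ozanski2017NSISingular, Lemma 4 (iii) and §6.3 (6.23)] -/
theorem normalisedPressure_sum_of_disjoint_of_contDiff {ι : Type*} (s : Finset ι)
    (u : ι → EuclideanSpace ℝ (Fin 3) → EuclideanSpace ℝ (Fin 3))
    (hdisj : ∀ i ∈ s, ∀ j ∈ s, i ≠ j → ∀ y, u i y = 0 ∨ u j y = 0)
    (hu : ∀ i ∈ s, ContDiff ℝ 1 (u i)) (hE : ∀ i ∈ s, (∫⁻ x, ‖u i x‖ₑ ^ 2) < ⊤) :
    (∫⁻ x, ‖(∑ i ∈ s, u i) x‖ₑ ^ 2) < ⊤ ∧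
      normalisedPressure (∑ i ∈ s, u i) = ∑ i ∈ s, normalisedPressure (u i) := by
  classical
  induction s using Finset.induction_on with
  | empty => simp
  | insert a s ha ih =>
    have hdisj' : ∀ i ∈ s, ∀ j ∈ s, i ≠ j → ∀ y, u i y = 0 ∨ u j y = 0 := fun i hi j hj =>
      hdisj i (mem_insert_of_mem hi) j (mem_insert_of_mem hj)
    obtain ⟨hES, hPS⟩ := ih hdisj' (fun i hi => hu i (mem_insert_of_mem hi))
      (fun i hi => hE i (mem_insert_of_mem hi))
    -- the new summand and the old sum are disjointly supported
    have hda : ∀ y, u a y = 0 ∨ (∑ i ∈ s, u i) y = 0 := by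
      intro y
      by_cases hy : u a y = 0
      · exact Or.inl hy
      · right
        rw [Finset.sum_apply]
        refine Finset.sum_eq_zero fun i hi => ?_
        have hne : a ≠ i := fun h => ha (h ▸ hi)
        exact (hdisj a (mem_insert_self a s) i (mem_insert_of_mem hi) hne y).resolve_left hy
    have hua : ContDiff ℝ 1 (u a) := hu a (mem_insert_self a s)
    have hEa := hE a (mem_insert_self a s)
    have hSa : ContDiff ℝ 1 (∑ i ∈ s, u i) := by
      have e : (∑ i ∈ s, u i) = fun x => ∑ i ∈ s, u i x := by
        funext x
        exact Finset.sum_apply x s u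
      rw [e]
      exact ContDiff.sum fun i hi => hu i (mem_insert_of_mem hi)
    rw [Finset.sum_insert ha, Finset.sum_insert ha]
    refine ⟨?_, ?_⟩
    · -- the energies add
      have hpt : ∀ x, ‖(u a + ∑ i ∈ s, u i) x‖ₑ ^ 2 =
          ‖u a x‖ₑ ^ 2 + ‖(∑ i ∈ s, u i) x‖ₑ ^ 2 := by
        intro x
        rcases hda x with h0 | h0
        · simp [h0]
        · rw [Pi.add_apply, h0]
          simp
      simp_rw [hpt]
      rw [lintegral_add_left (hua.continuous.measurable.enorm.pow_const 2)]
      exact ENNReal.add_lt_top.2 ⟨hEa, hES⟩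
    · rw [normalisedPressure_add_of_disjoint_of_contDiff hda hua hEa hSa hES, hPS]

/-- The same, under the tree's `Pairwise` phrasing of disjoint supports over the whole index type.
[cite: Ozanski2017NSISingular, Lemma 4 (iii)] -/
theorem normalisedPressure_sum_of_pairwise_disjoint_of_contDiff {ι : Type*} [Fintype ι]
    (u : ι → EuclideanSpace ℝ (Fin 3) → EuclideanSpace ℝ (Fin 3))
    (hdisj : Pairwise fun i j => ∀ y, u i y = 0 ∨ u j y = 0)
    (hu : ∀ i, ContDiff ℝ 1 (u i)) (hE : ∀ i, (∫⁻ x, ‖u i x‖ₑ ^ 2) < ⊤) :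
    normalisedPressure (∑ i, u i) = ∑ i, normalisedPressure (u i) :=
  (normalisedPressure_sum_of_disjoint_of_contDiff Finset.univ u
    (fun _ _ _ _ hne => hdisj hne) (fun i _ => hu i) (fun i _ => hE i)).2

end Literature.Analysis.FluidPDE
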